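import Literature.NumberTheory.EllipticCurves.RootNumberTwistProofs
import Literature.NumberTheory.EllipticCurves.SzpiroLocalDataProofs
import Literature.NumberTheory.EllipticCurves.GlobalMinimalModelProofs
import Literature.NumberTheory.QuadraticFields.JacobiCharacter
import Literature.NumberTheory.QuadraticForms.HilbertSymbolRatOdd
import HarnessLib

/-!
# `aₙ(E^{(D)}) = (D / n) aₙ(E)` for an odd fundamental discriminant `D` prime to the conductor

Let `E / ℚ` be an elliptic curve and `D ≡ 1 (mod 4)` a squarefree integer (an odd fundamental
discriminant) such that `E` has good reduction at every prime dividing `D`. Then the Dirichlet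
coefficients of Mathlib's `L`-function of the quadratic twist `E^{(D)}`
(`WeierstrassCurve.quadraticTwist`) are those of `E` twisted by the Kronecker character
`χ_D = (· / |D|)` (Cox, *Primes of the form x² + ny²*, Lemma 1.14), **for all `n ≥ 1`**:

`aₙ(E^{(D)}) = (n / |D|) · aₙ(E)`   (`LFunction_quadraticTwist_apply_of_emod_four_eq_one`).

This is the classical `L(E^{(D)}, s) = L(E ⊗ χ_D, s)` (Silverman *AEC* X.2, X.5, Exercise 10.16;
Gross–Zagier 1986, IV (0.1); Darmon 2004, §3.6, `E'` "the twist of `E` over `K`"), proved place by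
place for the Euler product, including the primes dividing `D`:

* at a place `v ∤ 2D` (prime `ℓ`): `D` is an `ℓ`-adic unit and `L_v(E^{(D)}, T) = L_v(E, χ_D(ℓ) T)`
  (`localEulerFactor_quadraticTwist` of `QuadraticTwistLocalPolynomialProofs`, with
  `(D / ℓ) = (ℓ / |D|)`, `jacobiSym_natAbs_eq_of_emod_four_eq_one`);
* at the place over `2` (`2 ∤ D`): `D = 1 + 4c` and `L_2(E^{(D)}, T) = L_2(E, χ_D(2) T)`
  (`localEulerFactor_quadraticTwist_two`, the sign being `+` iff `D ≡ 1 (mod 8)` iff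
  `(2 / |D|) = 1`, `jacobiSym_two_natAbs_eq_one_iff`);
* **at a place `v ∣ D`** (`ℓ` odd, `ℓ ∥ D`, good reduction of `E`): the twist has *additive*
  reduction (`hasAdditiveReductionAt_quadraticTwist_of_dvd`: for a global minimal model `W` of `E`
  the equation `W^{(D)} = (0, D b₂/4, 0, D² b₄/2, D³ b₆/4)` is `v`-integral with `v(Δ) = 6 < 12`,
  hence minimal at `v`, and `v(c₄) ≥ 2 > 0`; Silverman *AEC* VII.1 Rem. 1.1, VII.5 Prop. 5.1(c)),
  so `L_v(E^{(D)}, T) = 1`, matching `χ_D(ℓ) = 0`;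
* the place-by-place identities are assembled by `ArithmeticFunction.eulerProduct_apply_eq_mul_of_forall`
  (`QuadraticTwistLFunctionProofs`).

Everything is proved; no definitions and no named facts. This is the elliptic-curve-side input of
the sign `w(E) w(E^{(d_K)}) = −1` of `L(E/K, s)` under the Heegner hypothesis for odd `d_K`
(`BSDHeegnerPointsSignTwistProofs`).

## References

* J. H. Silverman, *The Arithmetic of Elliptic Curves*, 2nd ed. 2009, VII.1 Rem. 1.1, VII.5 Prop. 5.1,
  X.2 Prop. 2.4, X.5 Cor. 5.4, Exercise 10.16.
* [Cox2013] D. A. Cox, *Primes of the form x² + ny²*, 2nd ed. (2013), §1.C Lemma 1.14.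
* [GrossZagier1986] B. H. Gross, D. B. Zagier, Invent. Math. 84 (1986), IV (0.1).
-/

noncomputable section

open scoped Classical NumberTheorySymbols

namespace WeierstrassCurve

open IsDedekindDomain IsDedekindDomain.HeightOneSpectrum NumberField Rat.HeightOneSpectrum IsLocalRing

/-! ### Valuations of integers at the finite places of `𝓞 ℚ` -/

section Valuations

variable (v : HeightOneSpectrum (𝓞 ℚ))

/-- The prime `p` under `v` has `v`-adic valuation `exp (−1)` (`v = (p)` in `𝓞 ℚ`;
`RatPlace.intValuation_natGenerator`). [folklore] -/
theorem valuation_ringOfIntegers_natCast_primesEquiv :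
    v.valuation ℚ ((primesEquiv v : ℕ) : ℚ) = WithZero.exp (-1 : ℤ) := by
  have h : v.valuation ℚ (algebraMap (𝓞 ℚ) ℚ ((natGenerator v : ℕ) : 𝓞 ℚ)) = WithZero.exp (-1 : ℤ) := by
    rw [valuation_of_algebraMap]
    exact Literature.NumberTheory.QuadraticForms.RatPlace.intValuation_natGenerator v
  rw [map_natCast] at h
  exact h

/-- An integer exactly divisible by the prime `p` under `v` has `v`-adic valuation `exp (−1)`.
[folklore] -/
theorem valuation_ringOfIntegers_intCast_eq_exp_neg_one {D : ℤ} (h1 : ((primesEquiv v : ℕ) : ℤ) ∣ D)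
    (h2 : ¬ ((primesEquiv v : ℕ) : ℤ) ^ 2 ∣ D) : v.valuation ℚ (D : ℚ) = WithZero.exp (-1 : ℤ) := by
  obtain ⟨e, rfl⟩ := h1
  have he : ¬ ((primesEquiv v : ℕ) : ℤ) ∣ e := fun ⟨f, hf⟩ ↦ h2 ⟨f, by rw [hf]; ring⟩
  push_cast
  rw [map_mul, valuation_ringOfIntegers_natCast_primesEquiv, valuation_ringOfIntegers_intCast_eq_one v he,
    mul_one]

end Valuations

/-! ### Good reduction read off from a minimal equation -/

section MinimalAt

variable {A : Type*} [CommRing A] [IsDedekindDomain A] {K : Type*} [Field K] [Algebra A K]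
  [IsFractionRing A K] {v : HeightOneSpectrum A} {W : WeierstrassCurve K}

/-- **Reduction type read off from a minimal equation (good case).** If `W / K` is itself minimal
at `v`, then `W` has good reduction at `v` iff `ord_v (Δ) = 0` (the predicate refers to the chosen
local minimal model, and two minimal models have discriminants of the same valuation;
Silverman, *AEC* VII.5, Prop. 5.1(a), VII.1, Prop. 1.3(b)). Companion of the tree's
`hasMultiplicativeReductionAt_iff_of_isMinimalAt`, `hasAdditiveReductionAt_iff_of_isMinimalAt`.
[cite: SilvermanAEC2009, VII.5 Prop. 5.1(a)] -/
theorem hasGoodReductionAt_iff_of_isMinimalAt (h : W.IsMinimalAt v) :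
    W.HasGoodReductionAt v ↔ v.valuation K W.Δ = 1 := by
  haveI : (W.baseChange (v.adicCompletion K)).IsMinimal (v.adicCompletionIntegers K) := h
  have hD : W.localMinimalModel v =
      ((W.baseChange (v.adicCompletion K)).exists_isMinimal (v.adicCompletionIntegers K)).choose •
        W.baseChange (v.adicCompletion K) := rfl
  have hE := isEquiv_valuation_maximalIdeal_of_le_one_iff (R := v.adicCompletionIntegers K)
    (L := v.adicCompletion K) (V := Valued.v)
    (valued_le_one_iff_mem_range_adicCompletionIntegers v)
  rw [HasGoodReductionAt, hasGoodReduction_iff_of_isMinimal_of_eq_smul (v.adicCompletionIntegers K) hD,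
    hasGoodReduction_iff, hE.eq_one_iff_eq_one]
  have hΔ : (W.baseChange (v.adicCompletion K)).Δ = (W.Δ : v.adicCompletion K) := by
    rw [baseChange, map_Δ]; rfl
  rw [hΔ]
  change _ ∧ Valued.v (algebraMap K (v.adicCompletion K) W.Δ) = 1 ↔ _
  rw [valued_algebraMap_adicCompletion]
  exact ⟨fun h' ↦ h'.2, fun h' ↦ ⟨inferInstance, h'⟩⟩

end MinimalAt

/-! ### The twist by `D` has additive reduction at the odd primes `ℓ ∥ D` of good reduction -/

section Ramified

variable (W : WeierstrassCurve ℚ) [W.IsElliptic]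

/-- **Twisting a curve of good reduction by a ramified character makes the reduction additive**
(odd residue characteristic). Let `W / ℚ` be a global minimal model with good reduction at the
place `v` over an odd prime `ℓ`, and `D` an integer with `ℓ ∥ D`. Then the quadratic twist
`W^{(D)} : y² = x³ + (D b₂/4) x² + (D² b₄/2) x + D³ b₆/4` has additive reduction at `v`: this
equation is `v`-integral with `v(Δ) = v(D⁶ Δ_W) = 6 < 12`, hence minimal at `v`
(Silverman, *AEC* VII.1, Remark 1.1), and `v(Δ) > 0`, `v(c₄) = v(D² c₄(W)) ≥ 2 > 0`
(VII.5, Prop. 5.1(c)). [cite: SilvermanAEC2009, VII.1 Remark 1.1 and VII.5 Prop. 5.1(c)] -/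
theorem hasAdditiveReductionAt_quadraticTwist_of_dvd [W.IsGloballyMinimal]
    (v : HeightOneSpectrum (𝓞 ℚ)) (hv2 : (primesEquiv v : ℕ) ≠ 2) {D : ℤ} (hD0 : D ≠ 0)
    (h1 : ((primesEquiv v : ℕ) : ℤ) ∣ D) (h2 : ¬ ((primesEquiv v : ℕ) : ℤ) ^ 2 ∣ D)
    (hgood : W.HasGoodReductionAt v) : (W.quadraticTwist (D : ℚ)).HasAdditiveReductionAt v := by
  have hpP : (primesEquiv v : ℕ).Prime := (primesEquiv v).2
  have hpZ : Prime ((primesEquiv v : ℕ) : ℤ) := Nat.prime_iff_prime_int.mp hpP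
  have hp2 : ¬ ((primesEquiv v : ℕ) : ℤ) ∣ 2 := fun h ↦
    hv2 ((Nat.prime_dvd_prime_iff_eq hpP Nat.prime_two).mp (Int.natCast_dvd_natCast.mp h))
  have hp4 : ¬ ((primesEquiv v : ℕ) : ℤ) ∣ 4 := fun h ↦
    (hpZ.dvd_or_dvd (show ((primesEquiv v : ℕ) : ℤ) ∣ 2 * 2 by norm_num; exact h)).elim hp2 hp2
  have hDq : (D : ℚ) ≠ 0 := by exact_mod_cast hD0
  haveI := W.isElliptic_quadraticTwist hDq
  set M : WeierstrassCurve ℤ := integralModelInt W with hM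
  have hWM : M.map (Int.castRingHom ℚ) = W := map_integralModelInt W
  have hWb₂ : W.b₂ = (M.b₂ : ℚ) := by rw [← congrArg WeierstrassCurve.b₂ hWM, map_b₂, eq_intCast]
  have hWb₄ : W.b₄ = (M.b₄ : ℚ) := by rw [← congrArg WeierstrassCurve.b₄ hWM, map_b₄, eq_intCast]
  have hWb₆ : W.b₆ = (M.b₆ : ℚ) := by rw [← congrArg WeierstrassCurve.b₆ hWM, map_b₆, eq_intCast]
  have hWc₄ : W.c₄ = (M.c₄ : ℚ) := by rw [← congrArg WeierstrassCurve.c₄ hWM, map_c₄, eq_intCast]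
  have hv4 : v.valuation ℚ (4 : ℚ) = 1 := by
    have h := valuation_ringOfIntegers_intCast_eq_one v (n := 4) (by exact_mod_cast hp4)
    simpa using h
  have hv2' : v.valuation ℚ (2 : ℚ) = 1 := by
    have h := valuation_ringOfIntegers_intCast_eq_one v (n := 2) (by exact_mod_cast hp2)
    simpa using h
  have hvD : v.valuation ℚ (D : ℚ) = WithZero.exp (-1 : ℤ) :=
    valuation_ringOfIntegers_intCast_eq_exp_neg_one v h1 h2
  have hvΔ : v.valuation ℚ W.Δ = 1 :=
    (hasGoodReductionAt_iff_of_isMinimalAt (v := v) (W := W) (IsGloballyMinimal.isMinimal v)).mp hgood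
  have hvb₂ : v.valuation ℚ W.b₂ ≤ 1 := hWb₂ ▸ valuation_ringOfIntegers_intCast_le_one v _
  have hvb₄ : v.valuation ℚ W.b₄ ≤ 1 := hWb₄ ▸ valuation_ringOfIntegers_intCast_le_one v _
  have hvb₆ : v.valuation ℚ W.b₆ ≤ 1 := hWb₆ ▸ valuation_ringOfIntegers_intCast_le_one v _
  have hvc₄ : v.valuation ℚ W.c₄ ≤ 1 := hWc₄ ▸ valuation_ringOfIntegers_intCast_le_one v _
  have he1 : WithZero.exp (-1 : ℤ) ≤ 1 := by
    rw [← WithZero.exp_zero]; exact WithZero.exp_le_exp.mpr (by norm_num)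
  -- the twist equation is `v`-integral
  have hint : (W.quadraticTwist (D : ℚ)).IsIntegralAt v := by
    refine (W.quadraticTwist (D : ℚ)).isIntegralAt_of_valuation_le_one v ?_ ?_ ?_ ?_ ?_
    · simp
    · simp only [quadraticTwist_a₂, map_div₀, map_mul, hv4, hvD, div_one]
      exact mul_le_one' he1 hvb₂
    · simp
    · simp only [quadraticTwist_a₄, map_div₀, map_mul, map_pow, hv2', hvD, div_one]
      exact mul_le_one' (pow_le_one' he1 2) hvb₄
    · simp only [quadraticTwist_a₆, map_div₀, map_mul, map_pow, hv4, hvD, div_one]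
      exact mul_le_one' (pow_le_one' he1 3) hvb₆
  -- `v(Δ) = 6`, so the equation is minimal at `v`
  have hΔ : v.valuation ℚ (W.quadraticTwist (D : ℚ)).Δ = WithZero.exp (-6 : ℤ) := by
    rw [quadraticTwist_Δ, map_mul, map_pow, hvD, hvΔ, mul_one, ← WithZero.exp_nsmul]
    norm_num
  have hmin : (W.quadraticTwist (D : ℚ)).IsMinimalAt v :=
    isMinimalAt_of_lt_valuation_Δ_holds hint (by rw [hΔ]; exact WithZero.exp_lt_exp.mpr (by norm_num))
  -- `v(Δ) > 0` and `v(c₄) ≥ 2 > 0`: additive reduction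
  refine (hasAdditiveReductionAt_iff_of_isMinimalAt hmin).mpr ⟨?_, ?_⟩
  · rw [hΔ, ← WithZero.exp_zero]
    exact WithZero.exp_lt_exp.mpr (by norm_num)
  · rw [quadraticTwist_c₄, map_mul, map_pow, hvD, ← WithZero.exp_nsmul]
    calc WithZero.exp (2 • (-1 : ℤ)) * v.valuation ℚ W.c₄ ≤ WithZero.exp (2 • (-1 : ℤ)) :=
          mul_le_of_le_one_right' hvc₄
      _ < 1 := by rw [← WithZero.exp_zero]; exact WithZero.exp_lt_exp.mpr (by norm_num)

end Ramified

/-! ### The local Euler factors of `E^{(D)}` at the places not dividing `D` -/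

section Unramified

variable (W : WeierstrassCurve ℚ) [W.IsElliptic]

/-- **The local factor of `E^{(D)}` at an odd place `v ∤ D`** (prime `ℓ`), `D ≡ 1 (mod 4)`: it is the
rescaling by `χ_D(ℓ) = (ℓ / |D|)` of that of `E` — `D` is an `ℓ`-adic unit, a square mod `ℓ` iff
`(D / ℓ) = (ℓ / |D|) = 1` (`localEulerFactor_quadraticTwist`, `jacobiSym_natAbs_eq_of_emod_four_eq_one`).
[folklore] -/
theorem localEulerFactor_quadraticTwist_of_odd_of_not_dvd {D : ℤ} (hD4 : D % 4 = 1)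
    (v : HeightOneSpectrum (𝓞 ℚ)) (hv2 : (primesEquiv v : ℕ) ≠ 2)
    (hvD : ¬ ((primesEquiv v : ℕ) : ℤ) ∣ D) :
    ((W.quadraticTwist (D : ℚ)).baseChange (v.adicCompletion ℚ)).localEulerFactor
        (v.adicCompletionIntegers ℚ) =
      ArithmeticFunction.ofPowerSeries (primesEquiv v : ℕ)
        (PowerSeries.rescale (J(((primesEquiv v : ℕ) : ℤ) | D.natAbs))
          ((W.baseChange (v.adicCompletion ℚ)).localPowerSeries (v.adicCompletionIntegers ℚ))) := by
  haveI := Fact.mk (primesEquiv v).2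
  haveI : NeZero (2 : v.adicCompletion ℚ) := ⟨by
    rw [← map_ofNat (algebraMap ℚ (v.adicCompletion ℚ)) 2]; exact (map_ne_zero _).mpr two_ne_zero⟩
  haveI : (W.baseChange (v.adicCompletion ℚ)).IsElliptic := by
    change (W.map _).IsElliptic; infer_instance
  set ℓ : ℕ := (primesEquiv v : ℕ) with hℓ
  have hℓp : ℓ.Prime := (primesEquiv v).2
  have hℓ2 : ¬ (ℓ : ℤ) ∣ 2 := by
    intro h
    have := (Nat.prime_dvd_prime_iff_eq hℓp Nat.prime_two).mp (Int.natCast_dvd_natCast.mp h)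
    exact hv2 this
  have hu := isUnit_adicCompletionIntegers_intCast v hvD
  have h2 : IsUnit (2 : v.adicCompletionIntegers ℚ) := by
    have := isUnit_adicCompletionIntegers_intCast v hℓ2
    simpa using this
  -- the twist at `v`
  have htw : (W.quadraticTwist (D : ℚ)).baseChange (v.adicCompletion ℚ) =
      (W.baseChange (v.adicCompletion ℚ)).quadraticTwist
        (algebraMap (v.adicCompletionIntegers ℚ) (v.adicCompletion ℚ) hu.unit) := by
    rw [baseChange, map_quadraticTwist, IsUnit.unit_spec, algebraMap_adicCompletionIntegers_intCast]
    rfl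
  rw [htw, localEulerFactor_quadraticTwist (v.adicCompletionIntegers ℚ) h2 _ hu.unit,
    natCard_residueField_adicCompletionIntegers v]
  congr 2
  -- the sign: `D̄` is a square in the residue field iff `(ℓ / |D|) = (D / ℓ) = 1`
  obtain ⟨e, he⟩ := exists_residueField_ringEquiv_zmod v
  have hsq : IsSquare (residue _ ((hu.unit : (v.adicCompletionIntegers ℚ)ˣ) : v.adicCompletionIntegers ℚ)) ↔
      IsSquare ((D : ZMod ℓ)) := by
    rw [IsUnit.unit_spec, ← isSquare_ringEquiv_iff e.toMulEquiv, RingEquiv.toMulEquiv_eq_coe,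
      RingEquiv.coe_toMulEquiv, he]
  have hd0 : (D : ZMod ℓ) ≠ 0 := by rwa [Ne, ZMod.intCast_zmod_eq_zero_iff_dvd]
  simp only [hsq]
  rw [Literature.NumberTheory.QuadraticFields.jacobiSym_natAbs_eq_of_emod_four_eq_one hD4
      (hℓp.odd_of_ne_two hv2), ← jacobiSym.legendreSym.to_jacobiSym]
  congr 1
  split_ifs with h
  · exact ((legendreSym.eq_one_iff ℓ hd0).mpr h).symm
  · exact ((legendreSym.eq_neg_one_iff ℓ).mpr h).symm

/-- **The local factor of `E^{(D)}` at the place over `2`**, `D ≡ 1 (mod 4)`: with `D = 1 + 4c` it is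
the rescaling by `χ_D(2) = (2 / |D|)` of that of `E` — the unramified twist at `2`, trivial on the
reduction iff `2 ∣ c` iff `D ≡ 1 (mod 8)` iff `(2 / |D|) = 1` (`localEulerFactor_quadraticTwist_two`,
`jacobiSym_two_natAbs_eq_one_iff`). [folklore] -/
theorem localEulerFactor_quadraticTwist_two_of_emod_four_eq_one {D : ℤ} (hD4 : D % 4 = 1)
    (v : HeightOneSpectrum (𝓞 ℚ)) (hv2 : (primesEquiv v : ℕ) = 2) :
    ((W.quadraticTwist (D : ℚ)).baseChange (v.adicCompletion ℚ)).localEulerFactor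
        (v.adicCompletionIntegers ℚ) =
      ArithmeticFunction.ofPowerSeries (primesEquiv v : ℕ)
        (PowerSeries.rescale (J(((primesEquiv v : ℕ) : ℤ) | D.natAbs))
          ((W.baseChange (v.adicCompletion ℚ)).localPowerSeries (v.adicCompletionIntegers ℚ))) := by
  haveI := Fact.mk (primesEquiv v).2
  haveI : NeZero (2 : v.adicCompletion ℚ) := ⟨by
    rw [← map_ofNat (algebraMap ℚ (v.adicCompletion ℚ)) 2]; exact (map_ne_zero _).mpr two_ne_zero⟩
  haveI : (W.baseChange (v.adicCompletion ℚ)).IsElliptic := by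
    change (W.map _).IsElliptic; infer_instance
  set c : ℤ := (D - 1) / 4 with hcdef
  have hdc : D = 1 + 4 * c := by omega
  -- `2 ∈ 𝔪_v`
  have hk : residue _ (2 : v.adicCompletionIntegers ℚ) = 0 := by
    have := residue_adicCompletionIntegers_intCast_eq_zero v (n := 2) (by rw [hv2]; norm_num)
    simpa using this
  -- the twist at `v`
  have htw : (W.quadraticTwist (D : ℚ)).baseChange (v.adicCompletion ℚ) =
      (W.baseChange (v.adicCompletion ℚ)).quadraticTwist
        (algebraMap (v.adicCompletionIntegers ℚ) (v.adicCompletion ℚ) (1 + 4 * (c : v.adicCompletionIntegers ℚ))) := by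
    rw [baseChange, map_quadraticTwist, show (1 + 4 * (c : v.adicCompletionIntegers ℚ)) =
      ((1 + 4 * c : ℤ) : v.adicCompletionIntegers ℚ) by push_cast; ring, ← hdc,
      algebraMap_adicCompletionIntegers_intCast]
    rfl
  rw [htw, localEulerFactor_quadraticTwist_two (v.adicCompletionIntegers ℚ) hk _ (c : v.adicCompletionIntegers ℚ),
    natCard_residueField_adicCompletionIntegers v]
  congr 2
  -- the sign: `∃ z, z² + z = c̄` iff `2 ∣ c` iff `D ≡ 1 (mod 8)` iff `(2 / |D|) = 1`
  obtain ⟨e, he⟩ := exists_residueField_ringEquiv_zmod v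
  have hiff : (∃ z : ResidueField (v.adicCompletionIntegers ℚ), z ^ 2 + z = residue _ (c : v.adicCompletionIntegers ℚ)) ↔
      (2 : ℤ) ∣ c := by
    constructor
    · rintro ⟨z, hz⟩
      have h1 : e (residue _ (c : v.adicCompletionIntegers ℚ)) = 0 := by
        rw [← hz, map_add, map_pow]
        exact sq_add_self_eq_zero_of_eq_two hv2 (e z)
      rw [he] at h1
      have h3 : ((primesEquiv v : ℕ) : ℤ) ∣ c := (ZMod.intCast_zmod_eq_zero_iff_dvd c _).mp h1
      rwa [hv2] at h3
    · intro h2c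
      refine ⟨0, ?_⟩
      rw [residue_adicCompletionIntegers_intCast_eq_zero v (by rw [hv2]; exact_mod_cast h2c)]
      ring
  have h8 : (2 : ℤ) ∣ c ↔ D % 8 = 1 := by omega
  simp only [hiff]
  rw [hv2]
  push_cast
  congr 1
  by_cases h2c : (2 : ℤ) ∣ c
  · rw [if_pos h2c]
    exact ((Literature.NumberTheory.QuadraticFields.jacobiSym_two_natAbs_eq_one_iff hD4).mpr (h8.mp h2c)).symm
  · rw [if_neg h2c]
    have h5 : D % 8 = 5 := by omega
    exact ((Literature.NumberTheory.QuadraticFields.jacobiSym_two_natAbs_eq_neg_one_iff hD4).mpr h5).symm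

end Unramified

/-! ### The global identity -/

section Global

variable (W : WeierstrassCurve ℚ) [W.IsElliptic]

/-- The identity for a global minimal model (see `LFunction_quadraticTwist_apply_of_emod_four_eq_one`).
[folklore] -/
theorem LFunction_quadraticTwist_apply_of_isGloballyMinimal [W.IsGloballyMinimal] {D : ℤ}
    (hD4 : D % 4 = 1) (hsq : Squarefree D)
    (hgood : ∀ v : HeightOneSpectrum (𝓞 ℚ), ((primesEquiv v : ℕ) : ℤ) ∣ D → W.HasGoodReductionAt v)
    (n : ℕ) :
    (W.quadraticTwist (D : ℚ)).LFunction n = J((n : ℤ) | D.natAbs) * W.LFunction n := by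
  have hD0 : D ≠ 0 := by rintro rfl; norm_num at hD4
  have hDq : (D : ℚ) ≠ 0 := by exact_mod_cast hD0
  haveI : (W.quadraticTwist (D : ℚ)).IsElliptic := W.isElliptic_quadraticTwist hDq
  rw [LFunction_eq_eulerProduct, LFunction_eq_eulerProduct]
  refine ArithmeticFunction.eulerProduct_apply_eq_mul_of_forall (P := fun _ ↦ True)
    (fun _ _ _ ↦ ⟨trivial, trivial⟩) (fun n : ℕ ↦ J((n : ℤ) | D.natAbs))
    (by exact_mod_cast jacobiSym.one_left D.natAbs)
    (fun m n ↦ by push_cast; exact jacobiSym.mul_left _ _ _) _ _ (fun v m _ ↦ ?_)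
    (eventually_cofinite_localEulerFactor_apply _) (eventually_cofinite_localEulerFactor_apply _) trivial
  haveI := Fact.mk (primesEquiv v).2
  have hℓ1 : 1 < (primesEquiv v : ℕ) := (primesEquiv v).2.one_lt
  by_cases hvD : ((primesEquiv v : ℕ) : ℤ) ∣ D
  · -- ramified place: the factor of the twist is trivial and `χ_D(ℓ) = 0`
    have hv2 : (primesEquiv v : ℕ) ≠ 2 := by
      intro h
      rw [h] at hvD
      have : D % 2 = 0 := Int.emod_eq_zero_of_dvd (by exact_mod_cast hvD)
      omega
    have hsq' : ¬ ((primesEquiv v : ℕ) : ℤ) ^ 2 ∣ D := by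
      intro h
      have hu := hsq ((primesEquiv v : ℕ) : ℤ) (by rw [← sq]; exact h)
      rw [Int.isUnit_iff_natAbs_eq, Int.natAbs_natCast] at hu
      exact (primesEquiv v).2.one_lt.ne' hu
    have hadd := W.hasAdditiveReductionAt_quadraticTwist_of_dvd v hv2 hD0 hvD hsq' (hgood v hvD)
    haveI : NeZero D.natAbs := ⟨Int.natAbs_ne_zero.mpr hD0⟩
    have hJ0 : J(((primesEquiv v : ℕ) : ℤ) | D.natAbs) = 0 := by
      rw [jacobiSym.eq_zero_iff_not_coprime, Int.gcd_natCast_natCast]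
      intro hcop
      have hdvd : (primesEquiv v : ℕ) ∣ D.natAbs := Int.natCast_dvd.mp hvD
      exact (primesEquiv v).2.one_lt.ne' (Nat.Coprime.eq_one_of_dvd hcop hdvd)
    rw [localEulerFactor_eq_one_of_hasAdditiveReduction _ hadd, ArithmeticFunction.one_apply]
    split_ifs with hm1
    · rw [hm1, localEulerFactor_apply_one, Nat.cast_one, jacobiSym.one_left, one_mul]
    · by_cases hpow : ∃ k, Nat.card (ResidueField (v.adicCompletionIntegers ℚ)) ^ k = m
      · obtain ⟨k, rfl⟩ := hpow
        rw [natCard_residueField_adicCompletionIntegers] at hm1 ⊢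
        have hk : k ≠ 0 := fun h ↦ hm1 (by rw [h, pow_zero])
        rw [Nat.cast_pow, jacobiSym.pow_left, hJ0, zero_pow hk, zero_mul]
      · rw [localEulerFactor_apply_eq_zero _ _ (by rwa [natCard_residueField_adicCompletionIntegers]) hpow,
          mul_zero]
  · -- unramified place
    have key : ((W.quadraticTwist (D : ℚ)).baseChange (v.adicCompletion ℚ)).localEulerFactor
        (v.adicCompletionIntegers ℚ) =
        ArithmeticFunction.ofPowerSeries (primesEquiv v : ℕ)
          (PowerSeries.rescale (J(((primesEquiv v : ℕ) : ℤ) | D.natAbs))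
            ((W.baseChange (v.adicCompletion ℚ)).localPowerSeries (v.adicCompletionIntegers ℚ))) := by
      by_cases hv2 : (primesEquiv v : ℕ) = 2
      · exact W.localEulerFactor_quadraticTwist_two_of_emod_four_eq_one hD4 v hv2
      · exact W.localEulerFactor_quadraticTwist_of_odd_of_not_dvd hD4 v hv2 hvD
    rw [key, localEulerFactor, natCard_residueField_adicCompletionIntegers]
    exact ArithmeticFunction.ofPowerSeries_rescale_apply hℓ1 (fun n : ℕ ↦ J((n : ℤ) | D.natAbs))
      (by exact_mod_cast jacobiSym.one_left D.natAbs)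
      (fun m n ↦ by push_cast; exact jacobiSym.mul_left _ _ _) _ m

/-- **`aₙ(E^{(D)}) = (n / |D|) aₙ(E)` for all `n`**, for an elliptic curve `E / ℚ` (any model `W`),
an odd fundamental discriminant `D` (`D ≡ 1 (mod 4)` squarefree) and good reduction of `E` at every
prime dividing `D`: the Dirichlet coefficients of Mathlib's `L`-function of the quadratic twist by
`ℚ(√D)` are those of `E` twisted by the Kronecker character `χ_D = (· / |D|)` — including at the
primes dividing `D`, where both sides vanish (Silverman, *AEC* X.2, Exercise 10.16; Gross–Zagier
1986, IV (0.1): `L(E/K, s) = L(E, s) L(E ⊗ ε, s)`). Reduced to a global minimal model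
(`hasGlobalMinimalModel_rat_holds`; both sides are isomorphism invariants, `LFunction_smul`,
`quadraticTwist_smul`, `hasGoodReductionAt_smul_iff_holds`). [cite: SilvermanAEC2009, X.2 and Exercise 10.16] -/
theorem LFunction_quadraticTwist_apply_of_emod_four_eq_one {D : ℤ} (hD4 : D % 4 = 1)
    (hsq : Squarefree D)
    (hgood : ∀ v : HeightOneSpectrum (𝓞 ℚ), ((primesEquiv v : ℕ) : ℤ) ∣ D → W.HasGoodReductionAt v)
    (n : ℕ) :
    (W.quadraticTwist (D : ℚ)).LFunction n = J((n : ℤ) | D.natAbs) * W.LFunction n := by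
  have hD0 : D ≠ 0 := by rintro rfl; norm_num at hD4
  have hDq : (D : ℚ) ≠ 0 := by exact_mod_cast hD0
  haveI : (W.quadraticTwist (D : ℚ)).IsElliptic := W.isElliptic_quadraticTwist hDq
  obtain ⟨C, hC⟩ := hasGlobalMinimalModel_rat_holds W
  haveI := hC
  have h1 : (C • W).LFunction = W.LFunction := LFunction_smul W C
  have h2 : ((C • W).quadraticTwist (D : ℚ)).LFunction = (W.quadraticTwist (D : ℚ)).LFunction := by
    rw [quadraticTwist_smul]
    exact LFunction_smul _ _
  have hgood' : ∀ v : HeightOneSpectrum (𝓞 ℚ), ((primesEquiv v : ℕ) : ℤ) ∣ D →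
      (C • W).HasGoodReductionAt v := fun v hv ↦ (hasGoodReductionAt_smul_iff_holds v W C).mpr (hgood v hv)
  rw [← h1, ← h2]
  exact LFunction_quadraticTwist_apply_of_isGloballyMinimal (C • W) hD4 hsq hgood' n

end Global

end WeierstrassCurve

end
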